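/-
Copyright (c) 2026 the pub-hodgecm-mathlib formalisation cell (harness21).  R90-TF SLAB, section S10 (Rogawski 1990, Ch. 13.8), W1-H9 PAYER STATEMENTS.
typist R90-C138-typ4 (g2) — the two PS-SPECIFIC PAYER STATEMENTS of (M3) (DEFS, 0 sorry; dealer R90-C138-plan (g2) 00:16:20Z on p08 (g0)'s W1-H9 SHAPE
OF RECORD 00:16:04Z; measure binders in C2's OWN currency — Borel + `IsHaarMeasure` — per RULING J-M3-1 00:24:36Z on p01 (g0)'s finding 00:24:09Z; level
pins `KG = U(Φ₃)(𝒪_w)`, `KHw = U(Φ₂)(𝒪_w) × U(Φ₁)(𝒪_w)` as hypotheses of (2)(3) per RULING J-M3-2 00:27:43Z on AUDIT S10#34 F-T41-1); one writer per file: these bytes go to R90-C138-p08 (g0) BY PASTE into `Theorems/R90S10UnramCharIdentityLetterDefs.lean` (p08 may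
replace the inlined (α)/(β″) bodies by his tokens `SphericalConstituentTraceLetter` ∕ `LocalCharTransferLetter` — they are spelled here VERBATIM in his
orientation so that the replacement is `Iff.rfl`).
-/
import Summits.HodgeConjecture.HodgeConjecture.Theorems.R90S10FrozenDatumDefs          -- ★ S10 FILE C2: `Gqs`, `HLoc`, `H1Loc`, `Pl`, `MatchE1`, `IsLevel`, `IsLocSmooth`
import Summits.HodgeConjecture.HodgeConjecture.Theorems.R90S3EndoExpansionIndPS          -- ★ S3 `h492` vocabulary: `cmPrincipalSeriesH`, `IsFiniteLength … I.asModule`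
import HarnessLib

/-!
# R90 · S10 — the two principal-series PAYER STATEMENTS behind (M3) (p. 219 L3) in p08's abstract-`I` currency

p08 (g0)'s shape of record (00:16:04Z, dealer «=» 00:16:20Z): (α) `SphericalConstituentTraceLetter KG νQw I πw := πw.IsSpherical KG ∧ ∀ φ, IsLocSmooth φ →
IsLevel KG φ → πw.smoothTrace νQw φ = I.smoothTrace νQw φ`; (β″) `LocalCharTransferLetter μ νQw νHw mHw mQw ρw I := ∀ fH φ, MatchE1 L μ w mHw mQw fH φ →
I.smoothTrace νQw φ = ρw.smoothTrace νHw fH`; (M3) `UnramCharIdentityLetter … πw ρw := ∃ W … I, (α) ∧ (β″)` ⇒ C2 `LiesOver` in ten lines.  ALL number theory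
then sits in the two PRINCIPAL-SERIES payer statements typed here as named `Prop`s (the payers — S3 ∕ E1 — prove `theorem localCharTransferLetter_cmPrincipalSeries :
PSLocalCharTransferLetter …` and `theorem sphericalConstituentTrace_cmPrincipalSeries : PSLineTraceLetter …`), plus the generic engine behind the second:

* `AdmissibleLineTraceLetter L w KG νQw` — GENERIC: an admissible finite-length smooth `I` of `G_w` with `I^{K}` a LINE has its level-`K` trace carried by
  every (hence THE) `K`-spherical constituent: (α)-body for every `K`-spherical constituent `πw` of `I` [BorelJacquet1979 §4.4; Cartier1979 §IV.1].
* `PSLineTraceLetter L w KG νQw` — the same for `I ≅ i_G(χ′) = cmPrincipalSeries L 3 w χ′` with `I^{K}` a line (unramified `χ′`; Iwasawa `G = BK`)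
  [Rogawski1990 §12.1 p. 171; §4.9 Prop. 4.9.1 (b) p. 55] — admissibility ★ `isAdmissible_cmPrincipalSeries`, finite length [BernsteinZelevinsky1977 §2.3].
* `PSLocalCharTransferLetter L μ w KG KHw νQw νHw mHw mQw` — Lemma 4.9.2 SIGNED with `ε_w = κ_w = 1` AT AN UNRAMIFIED PLACE: under the ⟪U⟫ guard at `w` and
  unit-volume Haar measures, for `ρ_w ≅ i_H(χ₂ ⊠ χ₁)` (`χ₁` smooth) UNRAMIFIED («`ρ_w^{K_H}` a line», token-free) there is `χ̃` (print: `χ̃ = χ·μ̃`) and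
  `I ≅ i_G(χ̃)` ADMISSIBLE with `I^{K}` a line such that (β″)-body holds: `Tr I(φ) = Tr ρ_w(f^H)` on C2 `MatchE1` pairs
  [Rogawski1990 §4.9 Lemma 4.9.2, (4.9.2), (4.9.4) pp. 55–56; §13.1 p. 199 ¶3 (the sign); §13.8 (ii) p. 218 L9] [vanDijk1972, Thm. p. 237].

CURRENCY NOTES. MEASURES: the closed letters bind `{_msG : MeasurableSpace (Gqs L w)} [BorelSpace (Gqs L w)] … (νQw) [νQw.IsHaarMeasure]` (and `[BorelSpace
(HLoc L w)] … [νHw.IsHaarMeasure]` on the `H`-side) — C2's own rows `S10Frozen.bsG ∕ hνQ` (:512–:517) and the `H`-side analogues — because ★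
`Representation.smoothTrace` is a genuine trace only against a Borel, left-invariant, finite-on-compacts measure (p01 (g0) finding 00:24:09Z: with an
arbitrary `νQw` the letter would assert `dim πw^{K₀} = dim I^{K₀}` at an unknown chosen level — unprovable); `IsHaarMeasure` yields `IsMulLeftInvariant` +
`IsFiniteMeasureOnCompacts` by instances.  `I` is kept ABSTRACT at carrier `Gqs L w` and identified with the principal series by `Nonempty (I.Equiv (cmPrincipalSeries L 3 w χ′))`
(the ★ idiom of `isConstituentOf_cmPrincipalSeries_iff`: the `unitaryGroupOfForm` carrier of `cmPrincipalSeries` meets `Gqs L w = (cmDatum L 3 Φ₃).Local w`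
definitionally but NOT at instance transparency, so `smoothTrace` ∕ `fixedPoints` are taken on `I`, never on `cmPrincipalSeries` itself) — and p08's (M3)
`∃ W … I, …` is fed by this `I` directly.  `χ̃` is EXISTENTIAL: the general dictionary `(χ₂, χ₁) ↦ χ̃ = χ·μ̃` (`T_H = T`) has no ★ token (★ `cmXiTorusChar`
takes norm-one characters — the CM torus family, which degenerates at an unramified place).  Statement-only: no `instance`, no `notation`, no named fact,
no Lines import (LAW L9); C5: tokens used by name from their homes; new tokens = the three `def`s.
HONEST LABEL: letters pay nothing; HC_CM is proved only modulo the 7 printed citations (2 remaining named inputs: hLiu418 = stmt-HodgeConjecture-24832,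
h413 = stmt-HodgeConjecture-24833) until rung 0 closes; REL ≠ ★ ≠ BUILT.

## References
* [Rogawski1990] J. D. Rogawski, *Automorphic Representations of Unitary Groups in Three Variables*, Ann. of Math. Stud. 123 (1990): §4.9 Prop. 4.9.1 (b)
  p. 55, Lemma 4.9.2 pp. 55–56; §12.1 p. 171; §13.1 p. 199 ¶3; §13.8 (13.8.3) p. 218 L5–L9, p. 219 L3.
* [BorelJacquet1979] A. Borel, H. Jacquet, *Automorphic forms and automorphic representations*, Proc. Sympos. Pure Math. 33.1 (1979), §4.4.
* [Cartier1979] P. Cartier, *Representations of 𝔭-adic groups: a survey*, Proc. Sympos. Pure Math. 33.1 (1979), §IV.1.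
* [BernsteinZelevinsky1977] I. N. Bernstein, A. V. Zelevinsky, *Induced representations of reductive 𝔭-adic groups I*, Ann. Sci. ÉNS 10 (1977), §2.3.
* [vanDijk1972] G. van Dijk, *Computation of certain induced characters of 𝔭-adic groups*, Math. Ann. 199 (1972), Thm. p. 237.
-/

set_option autoImplicit false
-- the mandated namespace repeats the single-problem summit's segment (`HodgeConjecture.HodgeConjecture`)
set_option linter.dupNamespace false

noncomputable section

open scoped RestrictedProduct Matrix MatrixGroups
open Filter MeasureTheory NumberField IsDedekindDomain CompactlySupported
open Literature.NumberTheory.Rogawski1990 Literature.NumberTheory.Automorphic Literature.NumberTheory.Automorphic.UnitaryGroup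
open Literature.NumberTheory.Automorphic.UnitaryGroup.CotangentForms Literature.NumberTheory.GaloisRepresentations
open Summit.HodgeConjecture.HodgeConjecture.Cruxes.H413.K2E1TraceFormulaBeta

namespace Summit.HodgeConjecture.HodgeConjecture.R90.S10

/-! ## §1 The generic engine: a `K`-LINE admissible finite-length `I` has its level-`K` trace carried by every `K`-spherical constituent -/

/-- **`AdmissibleLineTraceLetter L w KG νQw`** — for every ADMISSIBLE smooth representation `I` of `G_w = U(Φ₃)(L⁺_w)` of FINITE LENGTH whose `KG`-fixed
space is a LINE and every irreducible `KG`-SPHERICAL class `πw` that is a CONSTITUENT of `I`: p08's (α)-body `πw.IsSpherical KG ∧ ∀ φ, IsLocSmooth φ → IsLevel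
KG φ → Tr πw(φ) = Tr I(φ)` (traces against `νQw`).  Why true: `I(φ) = e_K I(φ) e_K` has trace `Tr(I(φ) | I^K)`; `V ↦ V^K` is exact for compact open `K`, so
`Tr(I(φ) | I^K) = Σ_τ m(τ) Tr(τ(φ) | τ^K)` over the constituents, and `dim I^K = 1` leaves exactly one spherical `τ = πw`, with `m(τ) = 1`.  Why it might fail:
no mathematical way (generic smooth representation theory); only a trace-convention mismatch, and `IrrClass.smoothTrace` IS `Representation.smoothTrace` of a
realisation (★ `IrrClass.smoothTrace_mk`). [cite: BorelJacquet1979, §4.4] [cite: Cartier1979, §IV.1] [cite: Rogawski1990, §4.9 Prop. 4.9.1 (b) p. 55; §13.8 p. 219 L3] -/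
def AdmissibleLineTraceLetter (L : Type) [Field L] [NumberField L] [IsCMField L] (w : Pl L) {_msG : MeasurableSpace (Gqs L w)} [BorelSpace (Gqs L w)]
    (KG : Subgroup (Gqs L w)) (νQw : Measure (Gqs L w)) [νQw.IsHaarMeasure] : Prop :=
  ∀ ⦃W : Type⦄ [AddCommGroup W] [Module ℂ W] (I : Representation ℂ (Gqs L w) W),
    I.IsAdmissible → IsFiniteLength (MonoidAlgebra ℂ (Gqs L w)) I.asModule → Module.finrank ℂ ↥(I.fixedPoints KG) = 1 →
      ∀ πw : IrrClass (Gqs L w), πw.IsSpherical KG → πw.IsConstituentOf I →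
        (πw.IsSpherical KG ∧ ∀ φ : Gqs L w → ℂ, IsLocSmooth φ → IsLevel KG φ → πw.smoothTrace νQw φ = I.smoothTrace νQw φ)

/-- Read-back, `Iff.rfl`. -/
theorem admissibleLineTraceLetter_iff (L : Type) [Field L] [NumberField L] [IsCMField L] (w : Pl L) {_msG : MeasurableSpace (Gqs L w)} [BorelSpace (Gqs L w)]
    (KG : Subgroup (Gqs L w)) (νQw : Measure (Gqs L w)) [νQw.IsHaarMeasure] :
    AdmissibleLineTraceLetter L w KG νQw ↔
      ∀ ⦃W : Type⦄ [AddCommGroup W] [Module ℂ W] (I : Representation ℂ (Gqs L w) W),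
        I.IsAdmissible → IsFiniteLength (MonoidAlgebra ℂ (Gqs L w)) I.asModule → Module.finrank ℂ ↥(I.fixedPoints KG) = 1 →
          ∀ πw : IrrClass (Gqs L w), πw.IsSpherical KG → πw.IsConstituentOf I →
            (πw.IsSpherical KG ∧ ∀ φ : Gqs L w → ℂ, IsLocSmooth φ → IsLevel KG φ → πw.smoothTrace νQw φ = I.smoothTrace νQw φ) :=
  Iff.rfl

/-! ## §2 Payer statement `sphericalConstituentTrace_cmPrincipalSeries` — (α) for the spherical constituent of an unramified principal series -/

/-- **`PSLineTraceLetter L w KG νQw`** — AT THE HYPERSPECIAL LEVEL `KG = U(Φ₃)(𝒪_w)` (pin `KG = cmLocalIntegralLevel L 3 (qsForm L) w`, C2 `S10Frozen.hKstd`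
:457 bytes; RULING J-M3-2 on AUDIT S10#34 F-T41-1 — print's statements live at hyperspecial levels, p. 14), for every character `χ′` of the diagonal torus of `U(Φ₃)(L⁺_w)` and every realisation `I ≅ i_G(χ′) = cmPrincipalSeries
L 3 w χ′` on the carrier `Gqs L w` whose `KG`-fixed space is a LINE (unramified `χ′`: Iwasawa `G = BK`): every `KG`-spherical constituent `πw` of `I` satisfies
p08's (α)-body (it is THE spherical constituent and carries the level-`K` trace of `I`).  = `AdmissibleLineTraceLetter` at `I` plus admissibility (★
`isAdmissible_cmPrincipalSeries`) and finite length of the rank-one principal series of `U(3)` ([BernsteinZelevinsky1977 §2.3]; ★ only for `GL_n`).  Why it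
might fail: finite length of `i_G(χ′)` on `U(3)(L⁺_v)` is print (Bernstein–Zelevinsky ∕ Casselman), not ★; mathematically safe.
[cite: Rogawski1990, §12.1 p. 171; §4.9 Prop. 4.9.1 (b) p. 55; §13.8 p. 219 L3] [cite: BernsteinZelevinsky1977, §2.3] [cite: BorelJacquet1979, §4.4] -/
def PSLineTraceLetter (L : Type) [Field L] [NumberField L] [IsCMField L] (w : Pl L) {_msG : MeasurableSpace (Gqs L w)} [BorelSpace (Gqs L w)]
    (KG : Subgroup (Gqs L w)) (νQw : Measure (Gqs L w)) [νQw.IsHaarMeasure] : Prop :=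
  KG = cmLocalIntegralLevel L 3 (qsForm L) w →
  ∀ (χ' : ↥(torusU (conjLocal L (IsCMField.complexConj L) w) (cmLocalForm L 3 w)) →* ℂˣ)
    ⦃W : Type⦄ [AddCommGroup W] [Module ℂ W] (I : Representation ℂ (Gqs L w) W),
    Nonempty (I.Equiv (cmPrincipalSeries L 3 w χ')) → Module.finrank ℂ ↥(I.fixedPoints KG) = 1 →
      ∀ πw : IrrClass (Gqs L w), πw.IsSpherical KG → πw.IsConstituentOf I →
        (πw.IsSpherical KG ∧ ∀ φ : Gqs L w → ℂ, IsLocSmooth φ → IsLevel KG φ → πw.smoothTrace νQw φ = I.smoothTrace νQw φ)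

/-- Read-back, `Iff.rfl`. -/
theorem psLineTraceLetter_iff (L : Type) [Field L] [NumberField L] [IsCMField L] (w : Pl L) {_msG : MeasurableSpace (Gqs L w)} [BorelSpace (Gqs L w)]
    (KG : Subgroup (Gqs L w)) (νQw : Measure (Gqs L w)) [νQw.IsHaarMeasure] :
    PSLineTraceLetter L w KG νQw ↔
      (KG = cmLocalIntegralLevel L 3 (qsForm L) w →
      ∀ (χ' : ↥(torusU (conjLocal L (IsCMField.complexConj L) w) (cmLocalForm L 3 w)) →* ℂˣ)
        ⦃W : Type⦄ [AddCommGroup W] [Module ℂ W] (I : Representation ℂ (Gqs L w) W),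
        Nonempty (I.Equiv (cmPrincipalSeries L 3 w χ')) → Module.finrank ℂ ↥(I.fixedPoints KG) = 1 →
          ∀ πw : IrrClass (Gqs L w), πw.IsSpherical KG → πw.IsConstituentOf I →
            (πw.IsSpherical KG ∧ ∀ φ : Gqs L w → ℂ, IsLocSmooth φ → IsLevel KG φ → πw.smoothTrace νQw φ = I.smoothTrace νQw φ)) :=
  Iff.rfl

/-! ## §3 Payer statement `localCharTransferLetter_cmPrincipalSeries` — Lemma 4.9.2 SIGNED (`ε_w = κ_w = 1`) at an unramified place -/

/-- **`PSLocalCharTransferLetter L μ w KG KHw νQw νHw mHw mQw`** — AT A FINITE PLACE `w` WHERE `L/L⁺` AND `μ` ARE UNRAMIFIED (the ⟪U⟫ guard, FILE A2c :106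
bytes), AT THE HYPERSPECIAL LEVELS `KG = U(Φ₃)(𝒪_w)`, `KHw = U(Φ₂)(𝒪_w) × U(Φ₁)(𝒪_w)` (pins = C2 `S10Frozen.hKstd` :457 and `S10HDatum.hKH` ∕ `hK₂std` ∕
`hK₁std` :292–:296 bytes; RULING J-M3-2 on AUDIT S10#34 F-T41-1: at an Iwahori `KG` the conclusion «`I^{K}` a line» is FALSE, `dim i_G(χ̃)^{Iw} = |W| = 2`)
and for Haar measures giving these levels volume `1`: for every inducing pair `(χ₂, χ₁)` (`χ₁` smooth) and every local factor
`ρ_w ≅ i_H(χ₂ ⊠ χ₁) = cmPrincipalSeriesH L w χ₂ χ₁` (★) that is UNRAMIFIED in the token-free sense «`ρ_w^{K_H}` is a line» (C2 `hline` :330), there are a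
character `χ̃` of the diagonal torus of `U(Φ₃)(L⁺_w)` (print: `χ̃ = χ·μ̃`, Lemma 4.9.2, `T_H = T`) and an ADMISSIBLE realisation `I ≅ i_G(χ̃) = cmPrincipalSeries
L 3 w χ̃` on `Gqs L w` with `I^{K}` a LINE (`χ̃` unramified because the guard makes `μ_w` unramified) such that p08's (β″)-body holds: for every C2
`MatchE1`-matched pair `(f^H, φ)` (:141: `IsLocSmooth ∧ IsLocSmooth ∧ IsLocalDeltaTransfer` at the `Δ‴` of record, families `mHw`, `mQw`),
`Tr I(φ) = Tr ρ_w(f^H)` — i.e. S3's socket `stub_R90_S3_print_492_indPS` ∕ ★ `h492` (`Theorems/R90S3EndoExpansionIndPS.lean` :109–:121) AT UNRAMIFIED DATA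
with the sign PINNED, `ε_w = κ_w = 1` (`G_w = U(Φ₃)` quasi-split, unit-volume measures), and `I` identified as a PRINCIPAL SERIES.  Why it might fail: Lemma
4.9.2 signed is ★ only for the CM torus family at an ANISOTROPIC `H′` (★ `inducedCharTransferSigned`); here `H′ = Φ₃` and `(χ₂, χ₁)` is a general unramified
pair — print only (van Dijk on both sides + the Jacobian (4.9.4)); the pinned sign is print's `ε_w = κ_w = 1` for unramified data (p. 56, p. 199 ¶3) — false
only if the `Δ‴` of record (`finExplicitCollection … conj_left_all … conj_right_all`) differs from print's `Δ` by a sign at some unramified `w`.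
[cite: Rogawski1990, §4.9 Lemma 4.9.2, (4.9.2), (4.9.4) pp. 55–56; §12.1 p. 171; §13.1 p. 199 ¶3; §13.8 p. 218 L9 (ii), p. 219 L3] [cite: vanDijk1972, Thm. p. 237] -/
def PSLocalCharTransferLetter (L : Type) [Field L] [NumberField L] [IsCMField L] (μ : HeckeCharacter L) (w : Pl L)
    {_msH : MeasurableSpace (HLoc L w)} {_msG : MeasurableSpace (Gqs L w)} [BorelSpace (HLoc L w)] [BorelSpace (Gqs L w)]
    {_qH : ∀ a : HLoc L w, MeasurableSpace (HLoc L w ⧸ Subgroup.centralizer ({a} : Set (HLoc L w)))}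
    {_qQ : ∀ γ : Gqs L w, MeasurableSpace (Gqs L w ⧸ Subgroup.centralizer ({γ} : Set (Gqs L w)))}
    (KG : Subgroup (Gqs L w)) (KHw : Subgroup (HLoc L w)) (νQw : Measure (Gqs L w)) (νHw : Measure (HLoc L w))
    [νQw.IsHaarMeasure] [νHw.IsHaarMeasure] (mHw : OrbitalMeasureFamily (HLoc L w)) (mQw : OrbitalMeasureFamily (Gqs L w)) : Prop :=
  (∀ W : PlacesOver L w, Algebra.IsUnramifiedAt (𝓞 ↥(maximalRealSubfield L)) W.1.asIdeal ∧ μ.IsUnramifiedAt W.1) →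
    KG = cmLocalIntegralLevel L 3 (qsForm L) w →
    KHw = (cmLocalIntegralLevel L 2 (Matrix.of fun i j : Fin 2 => if i.val + j.val + 1 = 2 then (1 : L) else 0) w).prod
      (cmLocalIntegralLevel L 1 (Matrix.of fun i j : Fin 1 => if i.val + j.val + 1 = 1 then (1 : L) else 0) w) →
    νHw (KHw : Set (HLoc L w)) = 1 → νQw (KG : Set (Gqs L w)) = 1 →
      ∀ (χ₂ : ↥(torusU (conjLocal L (IsCMField.complexConj L) w) (cmLocalForm L 2 w)) →* ℂˣ) (χ₁ : H1Loc L w →* ℂˣ),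
        IsOpen ((χ₁.ker : Subgroup (H1Loc L w)) : Set (H1Loc L w)) →
          ∀ ⦃Vw : Type⦄ [AddCommGroup Vw] [Module ℂ Vw] (ρw : Representation ℂ (HLoc L w) Vw),
            Nonempty (ρw.Equiv (cmPrincipalSeriesH L w χ₂ χ₁)) → Module.finrank ℂ ↥(ρw.fixedPoints KHw) = 1 →
              ∃ (χt : ↥(torusU (conjLocal L (IsCMField.complexConj L) w) (cmLocalForm L 3 w)) →* ℂˣ)
                (W : Type) (_ : AddCommGroup W) (_ : Module ℂ W) (I : Representation ℂ (Gqs L w) W),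
                Nonempty (I.Equiv (cmPrincipalSeries L 3 w χt)) ∧ I.IsAdmissible ∧ Module.finrank ℂ ↥(I.fixedPoints KG) = 1 ∧
                  ∀ (fH : HLoc L w → ℂ) (φ : Gqs L w → ℂ), MatchE1 L μ w mHw mQw fH φ → I.smoothTrace νQw φ = ρw.smoothTrace νHw fH

/-- Read-back, `Iff.rfl`. -/
theorem psLocalCharTransferLetter_iff (L : Type) [Field L] [NumberField L] [IsCMField L] (μ : HeckeCharacter L) (w : Pl L)
    {_msH : MeasurableSpace (HLoc L w)} {_msG : MeasurableSpace (Gqs L w)} [BorelSpace (HLoc L w)] [BorelSpace (Gqs L w)]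
    {_qH : ∀ a : HLoc L w, MeasurableSpace (HLoc L w ⧸ Subgroup.centralizer ({a} : Set (HLoc L w)))}
    {_qQ : ∀ γ : Gqs L w, MeasurableSpace (Gqs L w ⧸ Subgroup.centralizer ({γ} : Set (Gqs L w)))}
    (KG : Subgroup (Gqs L w)) (KHw : Subgroup (HLoc L w)) (νQw : Measure (Gqs L w)) (νHw : Measure (HLoc L w))
    [νQw.IsHaarMeasure] [νHw.IsHaarMeasure] (mHw : OrbitalMeasureFamily (HLoc L w)) (mQw : OrbitalMeasureFamily (Gqs L w)) :
    PSLocalCharTransferLetter L μ w KG KHw νQw νHw mHw mQw ↔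
      ((∀ W : PlacesOver L w, Algebra.IsUnramifiedAt (𝓞 ↥(maximalRealSubfield L)) W.1.asIdeal ∧ μ.IsUnramifiedAt W.1) →
        KG = cmLocalIntegralLevel L 3 (qsForm L) w →
        KHw = (cmLocalIntegralLevel L 2 (Matrix.of fun i j : Fin 2 => if i.val + j.val + 1 = 2 then (1 : L) else 0) w).prod
          (cmLocalIntegralLevel L 1 (Matrix.of fun i j : Fin 1 => if i.val + j.val + 1 = 1 then (1 : L) else 0) w) →
        νHw (KHw : Set (HLoc L w)) = 1 → νQw (KG : Set (Gqs L w)) = 1 →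
          ∀ (χ₂ : ↥(torusU (conjLocal L (IsCMField.complexConj L) w) (cmLocalForm L 2 w)) →* ℂˣ) (χ₁ : H1Loc L w →* ℂˣ),
            IsOpen ((χ₁.ker : Subgroup (H1Loc L w)) : Set (H1Loc L w)) →
              ∀ ⦃Vw : Type⦄ [AddCommGroup Vw] [Module ℂ Vw] (ρw : Representation ℂ (HLoc L w) Vw),
                Nonempty (ρw.Equiv (cmPrincipalSeriesH L w χ₂ χ₁)) → Module.finrank ℂ ↥(ρw.fixedPoints KHw) = 1 →
                  ∃ (χt : ↥(torusU (conjLocal L (IsCMField.complexConj L) w) (cmLocalForm L 3 w)) →* ℂˣ)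
                    (W : Type) (_ : AddCommGroup W) (_ : Module ℂ W) (I : Representation ℂ (Gqs L w) W),
                    Nonempty (I.Equiv (cmPrincipalSeries L 3 w χt)) ∧ I.IsAdmissible ∧ Module.finrank ℂ ↥(I.fixedPoints KG) = 1 ∧
                      ∀ (fH : HLoc L w → ℂ) (φ : Gqs L w → ℂ), MatchE1 L μ w mHw mQw fH φ → I.smoothTrace νQw φ = ρw.smoothTrace νHw fH) :=
  Iff.rfl

/-! ## §4 The generic engine pays §2 modulo admissibility + finite length of the principal series (pure logic, recorded for p08's reduction) -/

/-- `AdmissibleLineTraceLetter` ⇒ `PSLineTraceLetter` GIVEN admissibility and finite length of every realisation `I ≅ i_G(χ′)` on `Gqs L w` (the two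
print inputs of §2, passed as hypotheses; pure logic). [cite: Rogawski1990, §12.1 p. 171] [cite: BernsteinZelevinsky1977, §2.3] -/
theorem psLineTraceLetter_of_admissibleLine (L : Type) [Field L] [NumberField L] [IsCMField L] (w : Pl L) {_msG : MeasurableSpace (Gqs L w)} [BorelSpace (Gqs L w)]
    (KG : Subgroup (Gqs L w)) (νQw : Measure (Gqs L w)) [νQw.IsHaarMeasure]
    (hadm : ∀ (χ' : ↥(torusU (conjLocal L (IsCMField.complexConj L) w) (cmLocalForm L 3 w)) →* ℂˣ)
      ⦃W : Type⦄ [AddCommGroup W] [Module ℂ W] (I : Representation ℂ (Gqs L w) W), Nonempty (I.Equiv (cmPrincipalSeries L 3 w χ')) →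
        I.IsAdmissible ∧ IsFiniteLength (MonoidAlgebra ℂ (Gqs L w)) I.asModule)
    (h : AdmissibleLineTraceLetter L w KG νQw) : PSLineTraceLetter L w KG νQw :=
  fun _hKG χ' _W _ _ I hI hline πw hsph hc => h I (hadm χ' I hI).1 (hadm χ' I hI).2 hline πw hsph hc

end Summit.HodgeConjecture.HodgeConjecture.R90.S10

end
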